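import Summits.BirchSwinnertonDyer.BirchSwinnertonDyer.Theses.UniversalToricDescent
import Summits.BirchSwinnertonDyer.BirchSwinnertonDyer.Theorems.UniversalToricDescentTwinAlgMuZeroAtThreeOfBetaRoadParam
import Summits.BirchSwinnertonDyer.BirchSwinnertonDyer.Theorems.UniversalToricDescentAcDualMuZeroCriterion
import Summits.BirchSwinnertonDyer.BirchSwinnertonDyer.Theorems.UniversalToricDescentResidualLinkOfLayerCount
import Summits.BirchSwinnertonDyer.BirchSwinnertonDyer.Theorems.UniversalToricDescentStrictPlaceNoPTorsion
import Literature.NumberTheory.EllipticCurves.KatoFineSelmerDual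
import HarnessLib

/-!
# Crux r205 `TwinAlgMuZeroAtThree` (stmt-BirchSwinnertonDyer-24737) — node `tau-corank-link` (crux-ideate g9, 2026-08-30)

**THE MOVE (a `Λ̄`-corank is an integer; `τ` halves; FINE forbids zero).**  Write `Λ̄ = 𝔽₃⟦T⟧`,
`S = Sel(K_∞, E′[3^∞])[3]` (classical Kummer conditions; layers `S_n = Sel₃(E′/K_n)`, the tree's `selmerTorsionOver`),
`R = Sel_(∅ at 𝔭, 0 at 𝔭′)(K_∞, E′[3^∞])[3]` (the crux's group, `selmerAc … 𝔭′ ∅`), and `d(𝔮) ∈ ℕ` for the `Λ̄`-corank of the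
image of `S` in the local cohomology above `𝔮 ∣ 3`.  The line of record closes bucket B by the LANDED finite-level two-sided
Poitou–Tate link `stub_residualLinkMult` (p745706): K1 at `𝔭` ∧ K1 at `𝔭′` ∧ K2_res ⟹ `R` finite, where K1 (a layer Heegner point
locally `3`-indivisible) enters ONLY as the RANK INPUT `3^{3ⁿ − 3^k + 1} ≤ #(S_n ⧸ S_n ∩ Z_𝔮(n))`
(`…ResidualLinkLayerRank.pow_le_natCard_selmerTorsion_quotient_of_K1`).  This node manufactures that rank input WITHOUT any
Heegner point being locally indivisible:

  (τ-corank lemma)  `d(𝔭) = d(𝔭′) = 1` as soon as  FINE‴ (`Sel₀(K_∞, E′[3^∞])[3]` finite)  and  `corank_Λ̄ S ≥ 1`.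
  Proof idea: `d(𝔮) ≤ corank_Λ̄` (Kummer condition above `𝔮`) `= 1` (Tate curve over the ramified tower, `E′(K_{∞,w})[3] = 0`);
  if `d(𝔭) = 0` then `S ∩ ker loc_𝔭` has finite index in `S`, hence (complex conjugation `τ` acts on `H¹(K_∞, E′[3])`, preserves `S`,
  swaps `ker loc_𝔭 ↔ ker loc_𝔭′`, preserves coranks) so does `S ∩ ker loc_𝔭′`, so does `S ∩ ker loc_𝔭 ∩ ker loc_𝔭′ ⊆ Sel₀[3]` — an
  infinite fine group, contradicting FINE‴.  Then `dim_{𝔽₃} loc_𝔭(S_n) = 3ⁿ − O(1)` (corank calculus + bucket-B control), i.e. the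
  two-sided link's rank input at BOTH primes, with an ineffective constant.

So in bucket B the crux is cut as   crux_B ⟸ FINE‴ ∧ (G⁰)‴ ∧ RANK‴ ∧ GR1‴ ∧ LINK‴ :
* FINE‴ `FineSelmerThreeTorsionFiniteAtThree` — verbatim the g8 piece (`Lines/fine_selmer_cut.lean`), restated here to keep the node
  self-contained.  TAG: WEAKER than the crux (PROVED: `fine_of_crux`) · leaf INSTRUMENTABLE per twin (Wuthrich Euler characteristic
  from layer-0 data [cite: Matar2018, Thm. 4.1] [cite: Wuthrich2007JAG, Thm. 6.1]; class-group criterion of the tree) · class-wide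
  IDEA-NEEDED (= anticyclotomic Coates–Sujatha A at `p = 3` [cite: CoatesSujatha2005, Conj. A] [cite: Matar2018, Conj. B]).
* (G⁰)‴ `SelmerLayerCorankPosMultAtThree` — «`#Sel₃(E′/K_n) ≥ 3^{3ⁿ − c}`»: the residual Selmer group has `Λ̄`-corank ≥ 1.
  TAG: WEAKER than K1‴ of `beta-road` (evidence, sorry-free: `layerCorankPos_of_localRankInput` ∘ `localRankInput_of_K1`; their side
  inputs — (H0) above `𝔮` up the tower, `Sel₃(E′/K_n)` finite — are the tree's `…StrictPlaceNoPTorsion`/`…TowerNoPTorsion`,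
  `…SelmerInftyLayerTorsionFinite`) and than (G)‴ of `fine-selmer-cut` + the two-term norm relations; printed source: Cornut–Vatsal non-torsion of CM points in the tower + Kummer
  injectivity (`E′(K_n)[3] = 0`) [cite: CornutVatsal2005, Thm. 1.10 (shape; `p ∤ N d_K` there)] [cite: BertoliniDarmon1996, §2.5
  (norm relations at `p ∥ N`, shape)] · leaf ATTACKABLE (port) / INSTRUMENTABLE (rank `E′(K₁)`).
* RANK‴ `LocalCorankFullOfFineMultAtThree` — THE NEW LEVER: FINE‴ → (G⁰)‴ → for every degree-one `𝔮 ∣ 3`: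
  `3^{3ⁿ} ≤ #(S_n ⧸ S_n ∩ Z_𝔮(n)) · 3^C` for `n ≥ n₀`.  TAG: UNDECIDED · leaf ATTACKABLE (size M: `Λ̄`-corank calculus for
  `selmerInfty κ`'s `3`-torsion — tree `…ResidualCorankOneCriterion`, `…TwinTowerCorankSum`, `…SelmerResidualRankLeOne` — plus the
  bucket-B control already landed for the link: `…LayerSelmerInjection`, `…StrictPlaceNoPTorsion`, `…TowerNoPTorsion`; the only
  Galois input is that `τ` normalises `Gal(K̄/K_∞)` and swaps `𝔭, 𝔭′`).  Its conclusion is WEAKER than K1 at `𝔮`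
  (PROVED: `localRankInput_of_K1`, from the tree's `pow_le_natCard_selmerTorsion_quotient_of_K1`).
  [cite: Matar2018, Thm. 3.3(a) (the `τ`-argument, applied there to the Heegner module; here to `S` itself)]
* GR1‴ `ResidualGrowthLeOneMultAtThree` — «`#Sel₃(E′/K_n) ≤ 3^{3ⁿ + C}`» = K2_res of `beta-road` v7–v16 in its layer form
  (`rank_Λ X + μ̃(X) ≤ 1` for the classical Selmer dual).  TAG: WEAKER than [K2a‴ ∧ K1‴] (tree:
  `residualCorankLeOneMult_of_ksTwinLambda` + `…LayerSelmerInjection`) and implied by the crux itself given RANK's corank bound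
  (`S ∩ ker loc_𝔭 ⊆ τR` finite, `d(𝔭) ≤ 1`; sketch only, not kernel-proved here) · leaf ATTACKABLE by an engine NO row of this crux
  uses for K2: RESIDUAL Kolyvagin descent over the ring-class layers (mod-`3` Kolyvagin with `y_n ∉ 3E′(K_n)`; `H¹(K(E′[3])/K, E′[3]) = 0`
  at `p = 3` is the tree's `…CentralElementH1Vanishing.sah_subsingleton_H1`), or Matar–Nekovář's Euler-system-free dihedral Iwasawa
  theory in the case `y_K ∉ 3E′(K)` (norm relations + control; `p ∤ N` there) [cite: MatarNekovar2019, Thms. 0.16–0.17 (= 4.8–4.9), §§1–3]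
  [cite: BertoliniDarmon1990, Thm. (shape)]
  [cite: Gross1991, §§3–4 (shape)] [cite: Matar2014, Thm. 1.2 (arXiv:1411.4685; `p ≥ 5`, `p ∤ N`)] [cite: Bertolini1995, Thm. (shape)]
  · INSTRUMENTABLE per twin (`dim_{𝔽₃} Sel₃(E′/K)`, `Sel₃(E′/K₁)` by descent).
* LINK‴ `ResidualLinkOfLocalCorankMultAtThree` — the landed link RE-WIRED: rank input at `𝔭` ∧ at `𝔭′` ∧ GR1 ⟹ `R[3]` finite.
  TAG: WEAKER than tree theorems modulo re-wiring (the proof of `…TwinAlgMuZeroAtThreeStubResidualLinkMult` with the call to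
  `pow_le_natCard_selmerTorsion_quotient_of_K1` replaced by the hypothesis; every other brick — `…TwoSidedLayerCountPT`,
  `…RelaxedStrictMixedCount`, `…ResidualLinkTransport(Residual)`, `…ResidualLayerControl`, `…ResidualLinkSigmaPassage` — BY NAME)
  · leaf ATTACKABLE (size S–M). [cite: Castella2017HeegnerBeilinsonFlach, App. A (A.4)–(A.7)] [cite: BurungaleCastellaKim2021, Thm. 4.1]
* C₀′ `TwinAlgMuZeroAtThreeGoodSSOfParam` BY NAME (`stub_goodSS` of `beta-road` v19).  The `τ`-corank lemma holds verbatim in C₀, but there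
  the Kummer condition above `𝔭` has `Λ̄`-corank 2 (supersingular, deeply ramified), so `d ≤ 1` fails and the link needs corank-one SIGNED
  conditions containing the signed Heegner classes — IDEA-NEEDED (rows `height-two-newton-signed-beta`, `signed_howard_half`).

**Composition** `TwinAlgMuZeroAtThree_of : FINE‴ → (G⁰)‴ → RANK‴ → GR1‴ → LINK‴ → C₀′ → crux` — kernel-checked, concludes the crux BY
NAME; bucket B through the route receptacle `isTorsion_and_exists_generator_of_finite_pTorsion`, `𝔭′` of degree one by
`degreeOne_of_dvd_of_heegner`; `sorry` ONLY inside the six `stub_*`.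
**What the node buys (honest).** Versus `beta-road` (K1‴ ∧ K2a‴): K1 (local indivisibility of a Heegner point at a prime of bad
reduction — only engines: BDP/ERL `p`-adic `L`-functions mod `p`, unprinted at `3 ∣ N`) is DELETED, and K2a‴ (Λ-adic Kolyvagin system +
Howard's DVR divisibilities at `3 ∥ N′`) is weakened to its residual shadow GR1‴; the price is FINE‴.  Versus `fine-selmer-cut` ∘ `beta-road`
((G)‴ ∧ FINE‴ ∧ CUT‴ ∧ K2a‴): the `τ`-argument is moved from the Heegner module (where it recovers K1 and still needs K2a‴ downstream)
to the whole residual Selmer group (where it feeds the landed link directly), so neither K1 nor K2a‴ appears.  Net: in bucket B,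
given the two algebraic stubs RANK‴, LINK‴ and the printed-shape (G⁰)‴,  crux_B ⟺ FINE‴ ∧ GR1‴  — two named conjectures each
STRICTLY WEAKER than the crux (Coates–Sujatha A at 3; residual corank one of the classical Selmer group).
**Disproof used** (`Disproof.lean`, no kill): honours `twinAlgMuZeroAtThree_false_without_heegner` — the Heegner hypothesis is
load-bearing through (G⁰)‴ (`corank_Λ̄ S ≥ 1` fails in the definite setting of the 15a1/`ℚ(√−23)` near-miss, where `S` is
`Λ̄`-cotorsion and `R` has rank one) and through `degreeOne_of_dvd_of_heegner`; surjectivity of `ρ̄₃` is consumed by RANK‴/LINK‴ as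
`E′(K_∞)[3] = 0`; the bucket guard and `Odd d_K` are not load-bearing (consistent with `Negative/GuardCuts.lean`).  Negatives
24881/15532 (adjoint / Beilinson–Flach) are not instances of any stub.
-/

noncomputable section

open scoped Classical NumberField

set_option linter.dupNamespace false
set_option autoImplicit false

namespace Summit.BirchSwinnertonDyer.BirchSwinnertonDyer.Cruxes.TwinAlgMuZeroAtThree.TauCorankLink

open NumberField IsDedekindDomain Field WeierstrassCurve Finset
open Literature.NumberTheory.EllipticCurves Literature.NumberTheory.EllipticCurves.IwasawaAlgebra
open Literature.NumberTheory.EllipticCurves.ZpExtension Literature.NumberTheory.EllipticCurves.GreenbergSelmer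
open Summit.BirchSwinnertonDyer.Rank1Residual.X11b Summit.BirchSwinnertonDyer.Rank1Residual.X11b.AcSelmer
open Summit.BirchSwinnertonDyer.BirchSwinnertonDyer.Theorems
open Summit.BirchSwinnertonDyer.BirchSwinnertonDyer.Theorems.UniversalToricDescentAcDualMuZero
open Summit.BirchSwinnertonDyer.BirchSwinnertonDyer.Theorems.UniversalToricDescentStrictPlace
open Summit.BirchSwinnertonDyer.BirchSwinnertonDyer.Theorems.UniversalToricDescentResidualLinkLayerRank
open Literature.NumberTheory.EllipticCurves.ModularForms (ModularParametrizationData heegnerPointComplexOfConductor)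

/-! ## §0 Layer objects (abbreviations of tree objects; no new mathematics) -/

section LayerObjects

variable {K : Type} [Field K] [NumberField K]

/-- `S_n = Sel₃(E′/K_n) ⊆ H¹(Gal(K̄/K_n), E′[3])` — the residual Selmer group of the layer `K_n = K̄^{κ.layerSubgroup n}`
(Kummer conditions at every place), the tree's `WeierstrassCurve.selmerTorsionOver`. [cite: PerrinRiou1987BSMF, §0 p. 401] -/
abbrev layerSel (W' : WeierstrassCurve ℚ) (κ : ZpExtension K 3) (n : ℕ) :
    AddSubgroup ((W'.baseChange K).torsionH1Over (3 : ℤ) (κ.layerSubgroup n)) :=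
  (W'.baseChange K).selmerTorsionOver (κ.layerSubgroup n) (3 : ℤ)

/-- `S_n ∩ Z_𝔮(n)` — the classes of `S_n` whose localisations at ALL places of `K_n` above `𝔮` vanish, exactly the subgroup
divided out in the two-sided layer count `…ResidualLinkOfLayerCount.residual_finite_of_twoSidedLayerCount` (`hcount`).
[cite: Castella2017HeegnerBeilinsonFlach, App. A (A.4)] -/
abbrev layerLocKer (W' : WeierstrassCurve ℚ) (κ : ZpExtension K 3) (n : ℕ) (𝔮 : HeightOneSpectrum (𝓞 K)) :
    AddSubgroup ↥(layerSel W' κ n) :=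
  (⨅ σ : absoluteGaloisGroup K,
    (AddMonoidHom.ker (Literature.NumberTheory.EllipticCurves.resOfLe (↥(geomTorsion (W'.baseChange K) (3 : ℤ)))
      (inf_le_left : κ.layerSubgroup n ⊓ decomp 𝔮 ≤ κ.layerSubgroup n))).comap
      (Literature.NumberTheory.EllipticCurves.conjH1 (κ.layerSubgroup n)
        (↥(geomTorsion (W'.baseChange K) (3 : ℤ))) σ)).addSubgroupOf
    (layerSel W' κ n)

/-- **Rank input at `𝔮`** (what K1 at `𝔮` is used for in the two-sided link): from some layer on, the image of `Sel₃(E′/K_n)` in the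
local cohomology above `𝔮` has at least `3^{3ⁿ − C}` elements (stated without subtraction: `3^{3ⁿ} ≤ # · 3^C`).
[cite: Castella2017HeegnerBeilinsonFlach, App. A (A.5) (shape)] -/
@[conjecture]
def LocalRankInput (W' : WeierstrassCurve ℚ) (κ : ZpExtension K 3) (𝔮 : HeightOneSpectrum (𝓞 K)) : Prop :=
  ∃ C n₀ : ℕ, ∀ n : ℕ, n₀ ≤ n → 3 ^ 3 ^ n ≤ Nat.card (↥(layerSel W' κ n) ⧸ layerLocKer W' κ n 𝔮) * 3 ^ C

/-- **Residual growth rate ≤ 1** of the classical Selmer group along the tower (K2_res, layer form; `Sel₃(E′/K_n)` finite is part of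
the statement, so no junk cardinality). [cite: GreenbergLNM1716, §1 (PDF pp. 60–62)] [cite: Howard2004HeegnerKolyvagin, Thm. B (shape)] -/
@[conjecture]
def LayerGrowthLeOne (W' : WeierstrassCurve ℚ) (κ : ZpExtension K 3) : Prop :=
  ∃ C : ℕ, ∀ n : ℕ,
    (layerSel W' κ n : Set ((W'.baseChange K).torsionH1Over (3 : ℤ) (κ.layerSubgroup n))).Finite ∧
      Nat.card ↥(layerSel W' κ n) ≤ 3 ^ (3 ^ n + C)

/-- **Residual growth rate ≥ 1**: `3^{3ⁿ} ≤ #Sel₃(E′/K_n) · 3^c` for all `n` (false if some `Sel₃(E′/K_n)` were infinite, by `Nat.card = 0`;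
so no junk). [cite: CornutVatsal2005, Thm. 1.10 (shape)] -/
@[conjecture]
def LayerCorankPos (W' : WeierstrassCurve ℚ) (κ : ZpExtension K 3) : Prop :=
  ∃ c : ℕ, ∀ n : ℕ, 3 ^ 3 ^ n ≤ Nat.card ↥(layerSel W' κ n) * 3 ^ c

end LayerObjects

/-! ## §1 The pieces (Props only; nothing asserted) -/

/-- **FINE‴ — `Sel₀(K_∞, E′[3^∞])[3]` is finite** (anticyclotomic Coates–Sujatha A/B for the twin at `p = 3`), crux binders verbatim,
both buckets; verbatim the g8 piece `FineSelmerCut.FineSelmerThreeTorsionFiniteAtThree`.  TAG: WEAKER than the crux (`fine_of_crux`);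
INSTRUMENTABLE; class-wide IDEA-NEEDED. [cite: Matar2018, Conj. B, Thm. 4.1] [cite: CoatesSujatha2005, Conj. A] [cite: Wuthrich2007JAG, Thm. 6.1] -/
@[conjecture]
def FineSelmerThreeTorsionFiniteAtThree : Prop :=
    ∀ (W' : WeierstrassCurve ℚ) [W'.IsElliptic] [W'.IsGloballyMinimal] (N' : ℕ) [NeZero N']
      (K : Type) [Field K] [NumberField K] (_Dt' : ModularParametrizationData W' N'),
      (Rank1Residual.Mult W' 3 ∧ ¬ 3 ∣ padicValInt 3 W'.minimalDiscriminantInt ∨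
        Rank1Residual.GoodSS W' 3 ∧ W'.frobeniusTrace 3 = 0) →
      W'.HasSurjectiveModNGaloisRep 3 → W'.conductorNorm ℤ = N' → IsImaginaryQuadratic K →
      SatisfiesHeegnerHypothesis N' K → Odd (NumberField.discr K) →
      ∀ (κ : ZpExtension K 3), κ.IsAnticyclotomic →
      ∀ (γ : absoluteGaloisGroup K) [Fact (κ.IsTopGenerator γ)]
        (𝔭 : HeightOneSpectrum (𝓞 K)), ((3 : ℕ) : 𝓞 K) ∈ 𝔭.asIdeal →
        𝔭.asIdeal.ramificationIdx (𝓞 ℚ) = 1 → 𝔭.asIdeal.inertiaDeg (𝓞 ℚ) = 1 →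
      ∀ (𝔭' : HeightOneSpectrum (𝓞 K)), ((3 : ℕ) : 𝓞 K) ∈ 𝔭'.asIdeal → 𝔭' ≠ 𝔭 →
      Set.Finite {s : (W'.baseChange K).fineSelmerInfty κ | (3 : ℕ) • s = 0}

/-- **(G⁰)‴ — the residual Selmer group grows** (bucket B): `3^{3ⁿ} ≤ #Sel₃(E′/K_n) · 3^c`.  TAG: WEAKER than K1‴
(evidence `layerCorankPos_of_localRankInput` ∘ `localRankInput_of_K1` + the tree's (H0)/finiteness theorems) and than (G)‴ + norm relations; printed shape (Cornut–Vatsal non-torsion +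
Kummer injectivity, `p ∤ N d_K` there); leaf ATTACKABLE (port to `3 ∥ N′`) / INSTRUMENTABLE.
[cite: CornutVatsal2005, Thm. 1.10 (shape)] [cite: BertoliniDarmon1996, §2.5 (shape)] -/
@[conjecture]
def SelmerLayerCorankPosMultAtThree : Prop :=
    ∀ (W' : WeierstrassCurve ℚ) [W'.IsElliptic] [W'.IsGloballyMinimal] (N' : ℕ) [NeZero N']
      (K : Type) [Field K] [NumberField K] (_Dt' : ModularParametrizationData W' N'),
      Rank1Residual.Mult W' 3 → ¬ 3 ∣ padicValInt 3 W'.minimalDiscriminantInt →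
      W'.HasSurjectiveModNGaloisRep 3 → W'.conductorNorm ℤ = N' → IsImaginaryQuadratic K →
      SatisfiesHeegnerHypothesis N' K → Odd (NumberField.discr K) →
      ∀ (κ : ZpExtension K 3), κ.IsAnticyclotomic → LayerCorankPos W' κ

/-- **RANK‴ — the `τ`-corank lemma (THE NEW LEVER)**: FINE‴ and corank `≥ 1` force FULL local corank at every degree-one `𝔮 ∣ 3`,
i.e. the two-sided link's rank input, with an ineffective constant.  TAG: UNDECIDED · leaf ATTACKABLE (size M; `Λ̄`-corank calculus +
the landed bucket-B control + `τ` swaps `𝔭, 𝔭′`). [cite: Matar2018, Thm. 3.3(a) (the `τ`-argument, shape)] [cite: GreenbergLNM1716, §1] -/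
@[conjecture]
def LocalCorankFullOfFineMultAtThree : Prop :=
    FineSelmerThreeTorsionFiniteAtThree → SelmerLayerCorankPosMultAtThree →
    ∀ (W' : WeierstrassCurve ℚ) [W'.IsElliptic] [W'.IsGloballyMinimal] (N' : ℕ) [NeZero N']
      (K : Type) [Field K] [NumberField K] (_Dt' : ModularParametrizationData W' N'),
      Rank1Residual.Mult W' 3 → ¬ 3 ∣ padicValInt 3 W'.minimalDiscriminantInt →
      W'.HasSurjectiveModNGaloisRep 3 → W'.conductorNorm ℤ = N' → IsImaginaryQuadratic K →
      SatisfiesHeegnerHypothesis N' K → Odd (NumberField.discr K) →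
      ∀ (κ : ZpExtension K 3), κ.IsAnticyclotomic →
      ∀ (𝔮 : HeightOneSpectrum (𝓞 K)), ((3 : ℕ) : 𝓞 K) ∈ 𝔮.asIdeal →
        𝔮.asIdeal.ramificationIdx (𝓞 ℚ) = 1 → 𝔮.asIdeal.inertiaDeg (𝓞 ℚ) = 1 →
      LocalRankInput W' κ 𝔮

/-- **GR1‴ — residual growth rate ≤ 1 of `Sel₃(E′/K_n)`** (bucket B) = K2_res of `beta-road` v7–v16, layer form.  TAG: WEAKER than
[K2a‴ ∧ K1‴] (tree `residualCorankLeOneMult_of_ksTwinLambda`); leaf ATTACKABLE (residual Kolyvagin over the layers — an engine unused by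
rows 1–17 for K2; or the Euler-system-free dihedral Iwasawa theory of Matar–Nekovář when `y_K ∉ 3E′(K)`) / INSTRUMENTABLE.
[cite: MatarNekovar2019, Thms. 0.16–0.17, §§1–3 (`p ∤ N` there)] [cite: BertoliniDarmon1990, Thm. (shape)] [cite: Matar2014, Thm. 1.2 (shape)]
[cite: Howard2004HeegnerKolyvagin, Thm. B] -/
@[conjecture]
def ResidualGrowthLeOneMultAtThree : Prop :=
    ∀ (W' : WeierstrassCurve ℚ) [W'.IsElliptic] [W'.IsGloballyMinimal] (N' : ℕ) [NeZero N']
      (K : Type) [Field K] [NumberField K] (_Dt' : ModularParametrizationData W' N'),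
      Rank1Residual.Mult W' 3 → ¬ 3 ∣ padicValInt 3 W'.minimalDiscriminantInt →
      W'.HasSurjectiveModNGaloisRep 3 → W'.conductorNorm ℤ = N' → IsImaginaryQuadratic K →
      SatisfiesHeegnerHypothesis N' K → Odd (NumberField.discr K) →
      ∀ (κ : ZpExtension K 3), κ.IsAnticyclotomic → LayerGrowthLeOne W' κ

/-- **LINK‴ — the finite-level two-sided Poitou–Tate link, re-wired**: rank input at `𝔭` and at `𝔭′` together with GR1 give finiteness of
`Sel_(∅,0)(K_∞, E′[3^∞])[3]` at `𝔭′` (bucket B).  TAG: WEAKER than the tree's `…TwinAlgMuZeroAtThreeStubResidualLinkMult` modulo replacing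
the call to `pow_le_natCard_selmerTorsion_quotient_of_K1` by the hypothesis; leaf ATTACKABLE (S–M).
[cite: Castella2017HeegnerBeilinsonFlach, App. A (A.4)–(A.7)] [cite: BurungaleCastellaKim2021, Thm. 4.1] [cite: GreenbergLNM1716, §3] -/
@[conjecture]
def ResidualLinkOfLocalCorankMultAtThree : Prop :=
    ∀ (W' : WeierstrassCurve ℚ) [W'.IsElliptic] [W'.IsGloballyMinimal] (N' : ℕ) [NeZero N']
      (K : Type) [Field K] [NumberField K] (_Dt' : ModularParametrizationData W' N'),
      Rank1Residual.Mult W' 3 → ¬ 3 ∣ padicValInt 3 W'.minimalDiscriminantInt →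
      W'.HasSurjectiveModNGaloisRep 3 → W'.conductorNorm ℤ = N' → IsImaginaryQuadratic K →
      SatisfiesHeegnerHypothesis N' K → Odd (NumberField.discr K) →
      ∀ (κ : ZpExtension K 3), κ.IsAnticyclotomic →
      ∀ (γ : absoluteGaloisGroup K) [Fact (κ.IsTopGenerator γ)]
        (𝔭 : HeightOneSpectrum (𝓞 K)), ((3 : ℕ) : 𝓞 K) ∈ 𝔭.asIdeal →
        𝔭.asIdeal.ramificationIdx (𝓞 ℚ) = 1 → 𝔭.asIdeal.inertiaDeg (𝓞 ℚ) = 1 →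
      ∀ (𝔭' : HeightOneSpectrum (𝓞 K)), ((3 : ℕ) : 𝓞 K) ∈ 𝔭'.asIdeal → 𝔭' ≠ 𝔭 →
      LocalRankInput W' κ 𝔭 → LocalRankInput W' κ 𝔭' → LayerGrowthLeOne W' κ →
      Set.Finite {s : selmerAc (W'.baseChange K) 3 κ 𝔭' ∅ | 3 • s = 0}

/-! ## §2 Evidence for the tags (no `sorry`) -/

/-- Pure arithmetic of the exponents: `3^(3ⁿ − 3^k + 1) ≤ X` with `k ≤ n` gives `3^(3ⁿ) ≤ X · 3^(3^k)`. [folklore] -/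
theorem pow_le_mul_pow_of_sub_le {k n X : ℕ} (hkn : k ≤ n) (h : 3 ^ (3 ^ n - 3 ^ k + 1) ≤ X) :
    3 ^ 3 ^ n ≤ X * 3 ^ 3 ^ k := by
  have hk : 3 ^ k ≤ 3 ^ n := Nat.pow_le_pow_right (by norm_num) hkn
  have hexp : 3 ^ n - 3 ^ k + 1 + 3 ^ k = 3 ^ n + 1 := by omega
  calc 3 ^ 3 ^ n ≤ 3 ^ (3 ^ n + 1) := Nat.pow_le_pow_right (by norm_num) (Nat.le_succ _)
    _ = 3 ^ (3 ^ n - 3 ^ k + 1) * 3 ^ 3 ^ k := by rw [← pow_add, hexp]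
    _ ≤ X * 3 ^ 3 ^ k := Nat.mul_le_mul_right _ h

/-- **K1 at `𝔮` ⟹ the rank input at `𝔮`** (so RANK‴'s conclusion is WEAKER than what `beta-road` feeds the link): the tree's
`pow_le_natCard_selmerTorsion_quotient_of_K1` (a norm-coherent Heegner family with a layer-`k` point locally `3`-indivisible at `𝔮`, (H0) at `𝔮`
up the tower, `Sel₃(E′/K_n)` finite) gives `3^{3ⁿ − 3^k + 1} ≤ #(S_n ⧸ S_n ∩ Z_𝔮(n))` for `n ≥ k`.
[cite: Castella2017HeegnerBeilinsonFlach, App. A (A.4)] [cite: BertoliniDarmon1996, §2.5] -/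
theorem localRankInput_of_K1 {K : Type} [Field K] [NumberField K] {N' : ℕ} [NeZero N'] {W' : WeierstrassCurve ℚ}
    {κ : ZpExtension K 3} {jbar : AlgebraicClosure K →+* ℂ} (F : HeegnerFamily N' W' K κ jbar)
    {γ : absoluteGaloisGroup K} {α : ℤ} (hα : α ^ 2 = 1) (hcoh : F.IsNormCompatible γ α)
    (𝔮 : HeightOneSpectrum (𝓞 K)) (k : ℕ)
    (h0 : ∀ (n : ℕ) (t : geomTorsion (W'.baseChange K) (3 : ℤ)),
      (∀ σ ∈ κ.layerSubgroup n ⊓ decomp 𝔮, σ • t = t) → t = 0)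
    (hK1 : ∀ (Q : geomPoints (W'.baseChange K))
      (hQ : ∀ σ ∈ κ.layerSubgroup k ⊓ decomp 𝔮, σ • ((3 : ℤ) • Q) = (3 : ℤ) • Q),
      (3 : ℤ) • Q = F.z k → (W'.baseChange K).kummerClassOver (κ.layerSubgroup k ⊓ decomp 𝔮) 3 Q hQ ≠ 0)
    (hfin : ∀ n : ℕ, (layerSel W' κ n :
      Set ((W'.baseChange K).torsionH1Over (3 : ℤ) (κ.layerSubgroup n))).Finite) :
    LocalRankInput W' κ 𝔮 := by
  refine ⟨3 ^ k, k, fun n hn ↦ ?_⟩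
  obtain ⟨m, rfl⟩ := Nat.exists_eq_add_of_le hn
  have h := pow_le_natCard_selmerTorsion_quotient_of_K1 (p := 3) F hα hcoh 𝔮 k m (h0 (k + m)) hK1 (hfin (k + m))
  exact pow_le_mul_pow_of_sub_le (Nat.le_add_right k m) h

/-- **Rank input at `𝔮` ⟹ (G⁰) for the instance**: a quotient of a finite group is no larger than the group.  So (G⁰)‴ is WEAKER than
K1‴ (with `localRankInput_of_K1`). [folklore] -/
theorem layerCorankPos_of_localRankInput {K : Type} [Field K] [NumberField K] {W' : WeierstrassCurve ℚ}
    {κ : ZpExtension K 3} {𝔮 : HeightOneSpectrum (𝓞 K)} (h : LocalRankInput W' κ 𝔮)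
    (hfin : ∀ n : ℕ, (layerSel W' κ n :
      Set ((W'.baseChange K).torsionH1Over (3 : ℤ) (κ.layerSubgroup n))).Finite) :
    LayerCorankPos W' κ := by
  obtain ⟨C, n₀, hC⟩ := h
  refine ⟨C + 3 ^ n₀, fun n ↦ ?_⟩
  haveI : Finite ↥(layerSel W' κ n) := (hfin n).to_subtype
  have hcardpos : 0 < Nat.card ↥(layerSel W' κ n) := Nat.card_pos
  rcases Nat.lt_or_ge n n₀ with hn | hn
  · calc 3 ^ 3 ^ n ≤ 3 ^ 3 ^ n₀ := Nat.pow_le_pow_right (by norm_num) (Nat.pow_le_pow_right (by norm_num) hn.le)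
      _ ≤ 3 ^ (C + 3 ^ n₀) := Nat.pow_le_pow_right (by norm_num) (Nat.le_add_left _ _)
      _ ≤ Nat.card ↥(layerSel W' κ n) * 3 ^ (C + 3 ^ n₀) := Nat.le_mul_of_pos_left _ hcardpos
  · have hq : Nat.card (↥(layerSel W' κ n) ⧸ layerLocKer W' κ n 𝔮) ≤ Nat.card ↥(layerSel W' κ n) := by
      have hLfin : Finite ↥(layerLocKer W' κ n 𝔮) :=
        Finite.of_injective (fun x : ↥(layerLocKer W' κ n 𝔮) ↦ (x : ↥(layerSel W' κ n))) Subtype.val_injective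
      have hLpos : 0 < Nat.card ↥(layerLocKer W' κ n 𝔮) := @Nat.card_pos _ ⟨0⟩ hLfin
      rw [(layerLocKer W' κ n 𝔮).card_eq_card_quotient_mul_card_addSubgroup]
      exact Nat.le_mul_of_pos_right _ hLpos
    calc 3 ^ 3 ^ n ≤ Nat.card (↥(layerSel W' κ n) ⧸ layerLocKer W' κ n 𝔮) * 3 ^ C := hC n hn
      _ ≤ Nat.card ↥(layerSel W' κ n) * 3 ^ C := Nat.mul_le_mul_right _ hq
      _ ≤ Nat.card ↥(layerSel W' κ n) * 3 ^ (C + 3 ^ n₀) :=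
        Nat.mul_le_mul_left _ (Nat.pow_le_pow_right (by norm_num) (Nat.le_add_right _ _))

/-- `Sel₀(K_∞, E[p^∞]) ≤ Sel_𝔭^Σ(K_∞, E[p^∞])` (verbatim the g8 lemma): the fine datum at `𝔭` IS Castella's strict datum.
[cite: Greenberg1989, §1 p. 98] [cite: Castella2018, Def. 2.2] -/
theorem fineSelmerInfty_le_selmerAc {K : Type} [Field K] [NumberField K] (W : WeierstrassCurve K) (p : ℕ)
    [Fact p.Prime] (κ : ZpExtension K p) (𝔭 : HeightOneSpectrum (𝓞 K)) (h𝔭 : ((p : ℕ) : 𝓞 K) ∈ 𝔭.asIdeal)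
    (S : Set (HeightOneSpectrum (𝓞 K))) :
    W.fineSelmerInfty κ ≤ selmerAc W p κ 𝔭 S := by
  intro c hc
  have hc' := (mem_strictSelmerGroupOver_iff c).mp hc
  exact (mem_selmerOver_iff c).mpr
    ⟨fun v hv _ σ ↦ hc'.1 v hv σ, hc'.2.1, fun σ ↦ hc'.2.2 𝔭 h𝔭 σ⟩

/-- Finiteness of the `n`-torsion passes to a smaller additive subgroup (verbatim the g8 lemma). [folklore] -/
theorem finite_nsmul_eq_zero_of_le {A : Type*} [AddCommGroup A] {B C : AddSubgroup A} (hle : B ≤ C) (n : ℕ)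
    (h : Set.Finite {s : C | n • s = 0}) : Set.Finite {s : B | n • s = 0} := by
  let ι : B → C := fun s ↦ ⟨s.1, hle s.2⟩
  have hι : Function.Injective ι := by
    intro a b hab
    apply Subtype.ext
    have h1 : ((ι a : C) : A) = ((ι b : C) : A) := congrArg Subtype.val hab
    exact h1
  refine Set.Finite.of_finite_image (h.subset ?_) hι.injOn
  rintro _ ⟨s, hs, rfl⟩
  have hs' : n • (s : A) = 0 := by
    have h1 := congrArg Subtype.val hs
    simpa using h1
  show n • ι s = 0
  exact Subtype.ext (by simpa [ι] using hs')

/-- **crux ⟹ FINE‴** (FINE‴ is WEAKER than the crux, both buckets; verbatim the g8 proof). [cite: Washington1997, §13.2] -/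
theorem fine_of_crux
    (h : Summit.BirchSwinnertonDyer.BirchSwinnertonDyer.Theses.UniversalToricDescent.TwinAlgMuZeroAtThree) :
    FineSelmerThreeTorsionFiniteAtThree := by
  intro W' _ _ N' _ K _ _ Dt' hbucket hsurj hN hK hH hodd κ hκ γ _ 𝔭 h𝔭 he hf 𝔭' h𝔭' hne
  obtain ⟨htors, g, hg, hi⟩ := h W' N' K Dt' hbucket hsurj hN hK hH hodd κ hκ γ 𝔭 h𝔭 he hf 𝔭' h𝔭' hne
  have hfin := finite_pTorsion_of_isTorsion_of_exists_generator
    (W'.baseChange K) 3 κ 𝔭' ∅ γ Set.finite_empty htors ⟨g, hg, hi⟩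
  exact finite_nsmul_eq_zero_of_le (fineSelmerInfty_le_selmerAc (W'.baseChange K) 3 κ 𝔭' h𝔭' ∅) 3 hfin

/-! ## §3 The six stubs of the node (the ONLY `sorry`s of this file) -/

/-- **stub FINE‴** — anticyclotomic Coates–Sujatha at `p = 3` for the twin (shared with node `fine-selmer-cut`).  UNDECIDED ·
INSTRUMENTABLE · class-wide IDEA-NEEDED. [cite: Matar2018, Conj. B, Thm. 4.1] [cite: CoatesSujatha2005, Conj. A] -/
theorem stub_fine : FineSelmerThreeTorsionFiniteAtThree := by
  sorry

/-- **stub (G⁰)‴** — `Λ̄`-corank of the residual Selmer group along the tower is ≥ 1 (port of Cornut–Vatsal non-torsion + the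
two-term norm relations of bucket B to `3 ∥ N′`).  UNDECIDED · ATTACKABLE · INSTRUMENTABLE. [cite: CornutVatsal2005, Thm. 1.10 (shape)] -/
theorem stub_corankPos : SelmerLayerCorankPosMultAtThree := by
  sorry

/-- **stub RANK‴** — the `τ`-corank lemma (the node's lever).  UNDECIDED · ATTACKABLE (size M).
[cite: Matar2018, Thm. 3.3(a) (the `τ`-argument, shape)] [cite: GreenbergLNM1716, §1] -/
theorem stub_rank : LocalCorankFullOfFineMultAtThree := by
  sorry

/-- **stub GR1‴** — residual growth rate ≤ 1 of `Sel₃(E′/K_n)` (residual Kolyvagin over the ring-class layers; or K2a‴).  UNDECIDED ·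
ATTACKABLE (size L: uniformity in `n` à la Matar) · INSTRUMENTABLE. [cite: BertoliniDarmon1990, Thm. (shape)] [cite: Matar2014, Thm. 1.2 (shape)] -/
theorem stub_growthLeOne : ResidualGrowthLeOneMultAtThree := by
  sorry

/-- **stub LINK‴** — the landed two-sided link with the rank input as hypothesis (re-wiring of p745706).  UNDECIDED · ATTACKABLE (S–M).
[cite: Castella2017HeegnerBeilinsonFlach, App. A (A.4)–(A.7)] [cite: BurungaleCastellaKim2021, Thm. 4.1] -/
theorem stub_link : ResidualLinkOfLocalCorankMultAtThree := by
  sorry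

/-- **stub C₀′** (`TwinAlgMuZeroAtThreeGoodSSOfParam`) BY NAME — unchanged from line `beta-road` v19.
[cite: Howard2004HeegnerKolyvagin, Thm. B (shape)] -/
theorem stub_goodSS : UniversalToricDescentBetaRoadParamDefs.TwinAlgMuZeroAtThreeGoodSSOfParam := by
  sorry

/-! ## §4 Composition: the crux BY NAME -/

/-- **Crux 24737 `TwinAlgMuZeroAtThree` BY NAME from the node's pieces.**  Bucket B: RANK‴ (fed by FINE‴ and (G⁰)‴) gives the rank input at
`𝔭` and — `𝔭′` being of degree one by the Heegner hypothesis (`degreeOne_of_dvd_of_heegner`, `3 ∣ N′`) — at `𝔭′`; GR1‴ gives the growth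
bound; LINK‴ gives finiteness of `Sel_(∅,0)(K_∞, E′[3^∞])[3]`; the route receptacle `isTorsion_and_exists_generator_of_finite_pTorsion`
concludes.  Bucket C₀: C₀′ BY NAME.  No `sorry` here. [cite: GreenbergVatsal2000, §2 Prop. (2.8)] [cite: Castella2017HeegnerBeilinsonFlach, App. A] -/
theorem TwinAlgMuZeroAtThree_of
    (hF : FineSelmerThreeTorsionFiniteAtThree) (hG0 : SelmerLayerCorankPosMultAtThree)
    (hrank : LocalCorankFullOfFineMultAtThree) (hgr : ResidualGrowthLeOneMultAtThree)
    (hlink : ResidualLinkOfLocalCorankMultAtThree)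
    (hC0 : UniversalToricDescentBetaRoadParamDefs.TwinAlgMuZeroAtThreeGoodSSOfParam) :
    Summit.BirchSwinnertonDyer.BirchSwinnertonDyer.Theses.UniversalToricDescent.TwinAlgMuZeroAtThree := by
  intro W' _ _ N' _ K _ _ Dt' hbucket hsurj hN hK hH hodd κ hκ γ _ 𝔭 h𝔭 he hf 𝔭' h𝔭' hne
  rcases hbucket with ⟨hm, htr⟩ | ⟨hss, ha⟩
  · -- `𝔭′` is of degree one: `3 ∣ N′` (multiplicative) and `K` is Heegner for `N′`
    have h3N : (3 : ℕ) ∣ N' := hN ▸ dvd_conductorNorm_of_mult hm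
    obtain ⟨he', hf'⟩ := degreeOne_of_dvd_of_heegner (p := 3) hK hH h3N h𝔭'
    -- rank inputs at `𝔭` and at `𝔭′` from the `τ`-corank lemma
    have hr : LocalRankInput W' κ 𝔭 :=
      hrank hF hG0 W' N' K Dt' hm htr hsurj hN hK hH hodd κ hκ 𝔭 h𝔭 he hf
    have hr' : LocalRankInput W' κ 𝔭' :=
      hrank hF hG0 W' N' K Dt' hm htr hsurj hN hK hH hodd κ hκ 𝔭' h𝔭' he' hf'
    -- residual growth ≤ 1
    have hg : LayerGrowthLeOne W' κ := hgr W' N' K Dt' hm htr hsurj hN hK hH hodd κ hκ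
    -- the re-wired two-sided link
    have hfin : Set.Finite {s : selmerAc (W'.baseChange K) 3 κ 𝔭' ∅ | 3 • s = 0} :=
      hlink W' N' K Dt' hm htr hsurj hN hK hH hodd κ hκ γ 𝔭 h𝔭 he hf 𝔭' h𝔭' hne hr hr' hg
    -- the landed receptacle
    haveI : (W'.baseChange K).IsElliptic := by rw [WeierstrassCurve.baseChange]; infer_instance
    exact isTorsion_and_exists_generator_of_finite_pTorsion (W'.baseChange K) 3 κ 𝔭' ∅ γ Set.finite_empty hfin
  · exact (UniversalToricDescentBetaRoadParamDefs.twinAlgMuZeroAtThreeGoodSSOfParam_iff.mp hC0)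
      W' N' K Dt' hss ha hsurj hN hK hH hodd κ hκ γ 𝔭 h𝔭 he hf 𝔭' h𝔭' hne

/-- **The node closes the crux from its six stubs** (inherits their `sorry`s). -/
theorem TwinAlgMuZeroAtThree_of_stubs :
    Summit.BirchSwinnertonDyer.BirchSwinnertonDyer.Theses.UniversalToricDescent.TwinAlgMuZeroAtThree :=
  TwinAlgMuZeroAtThree_of stub_fine stub_corankPos stub_rank stub_growthLeOne stub_link stub_goodSS

/-- **Sanity: the line of record implies the node's FINE‴** (K1‴ ∧ K2a‴ ∧ C₀′ ⟹ crux ⟹ FINE‴), so the node does not strengthen the leaf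
shared with `fine-selmer-cut`. [cite: Howard2004HeegnerKolyvagin, Thm. 2.3.1 (shape only)] -/
theorem fine_of_betaRoadParamStubs
    (hK1 : UniversalToricDescentBetaRoadParamDefs.PrincipalHeegnerIndivisibleMultOfParamAtThree)
    (hK2 : UniversalToricDescentKsTwinLambdaDefs.KsTwinLambdaAdicAtThree)
    (hC0 : UniversalToricDescentBetaRoadParamDefs.TwinAlgMuZeroAtThreeGoodSSOfParam) :
    FineSelmerThreeTorsionFiniteAtThree :=
  fine_of_crux (UniversalToricDescentTwinAlgMuZeroAtThreeOfBetaRoadParam.twinAlgMuZeroAtThree_of_betaRoadParamStubs hK1 hK2 hC0)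

end Summit.BirchSwinnertonDyer.BirchSwinnertonDyer.Cruxes.TwinAlgMuZeroAtThree.TauCorankLink

end
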